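import Literature.Geometry.Lorentzian.NearIdentityPullback
import HarnessLib

/-!
# Crux `DriftCapture` (stmt-FinalStateConjecture-17391), stub `stub_glueForwardChain`:
# Christoffel transport — the Hessian of a transition map is controlled by the first
# derivatives of the two metric fields it intertwines (seam rigidity (G1)/(G1K))

Brick for the registered stub `stub_glueForwardChain` of the skeleton
`Summits/FinalStateConjecture/FinalStateConjecture/Cruxes/DriftCapture/Lines/birth.lean`
(crux stmt-FinalStateConjecture-17391). On the overlap of two consecutive window charts the
transition map `θ = Φ₂⁻¹ ∘ Φ₁` intertwines the two pulled-back metric fields,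
`bilinPullback θ B₂ = B₁`, i.e. `B₁(y)(v, w) = B₂(θ y)(Dθ_y v, Dθ_y w)`
(`Literature.Geometry.Lorentzian.bilinPullback_apply`). Classically this is the transformation law
of the Christoffel symbols, `Γ₁ = θ^*Γ₂`, i.e. `∂²θ = (∂θ) Γ₁ − Γ₂(θ)(∂θ, ∂θ)` (O'Neill 1983,
Ch. 3: the Levi-Civita connection is preserved by isometries, Prop. 3.59, and is given by the
Koszul formula, Thm. 3.11). Its analytic content, in Mathlib's `fderiv` language and with no
connection formalism, is the pointwise estimate proved here:

* `fderiv_apply₃_eq_of_bilinPullback_eq` — differentiating the intertwining identity at `x` in the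
  direction `u`: with `L = Dθ(x)`, `H = D²θ(x)`, `A = B₂(θ x)`,
  `DB₁(x)[u](v, w) = DB₂(θ x)[L u](L v, L w) + A(H(u, v), L w) + A(L v, H(u, w))`;
* `two_mul_apply_apply_eq_koszul` — the Koszul/Christoffel trick (pure trilinear algebra): for `A`
  and `H` symmetric, `2 A(H(u, v), L w)` is the alternating sum `S(u,v,w) + S(v,u,w) − S(w,u,v)` of
  `S(u, v, w) := A(H(u, v), L w) + A(L v, H(u, w))`;
* `exists_apply_eq_and_norm_le` — a linear self-map of a finite-dimensional space that is bounded
  below, `‖v‖ ≤ Θ ‖L v‖`, is onto, with `‖L⁻¹ q‖ ≤ Θ ‖q‖`;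
* `norm_fderiv_fderiv_le_of_bilinPullback_eq` — the explicit estimate
  `‖D²θ(x)‖ ≤ (3/2) |ν| (|Θ| + |Θ|⁴) (‖DB₁(x)‖ + ‖DB₂(θ x)‖)` when `‖Dθ(x)‖ ≤ Θ`,
  `‖v‖ ≤ Θ ‖Dθ(x) v‖`, `B₂(θ x)` is symmetric and `ν`-nondegenerate (`‖p‖ ≤ ν ‖B₂(θ x) p‖`);
* `norm_iteratedFDeriv_two_le_of_bilinPullback_eq` — the registered form, for
  `‖iteratedFDeriv ℝ 2 θ x‖` and with the constant existentially packaged (`K = K(Θ, ν) ≥ 0`).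

In the application `B₁, B₂` are `η +` (`ε`-small `C¹` fields), so the brick gives `‖D²θ‖ ≲ ε`, the
oscillation input of the affine-approximation brick of seam rigidity (G1).
Mathlib + the `Literature` file `Geometry/Lorentzian/BilinPullbackEstimates` (`bilinPullback`,
`bilinPullback_apply`) only; no definitions, no named facts.

References: B. O'Neill, *Semi-Riemannian Geometry*, Academic Press 1983, Ch. 3 (Def. 3.9,
Thm. 3.11 (Koszul formula), Prop. 3.13 (Christoffel symbols), Prop. 3.59); all statements here are
`[folklore]`.
-/

-- the doubled `FinalStateConjecture.FinalStateConjecture` path component trips dupNamespace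
set_option linter.dupNamespace false
-- operator norms of trilinear maps `E4 →L[ℝ] E4 →L[ℝ] E4 →L[ℝ] ℝ` (the type of `fderiv ℝ B x` for a
-- field of bilinear forms `B`) need nested instance synthesis of depth `3` (Mathlib's own setting)
set_option maxSynthPendingDepth 3

noncomputable section

namespace Summit.FinalStateConjecture.FinalStateConjecture.Theorems.RenormalisedDrift.DriftCapture

open Set Filter Topology
open Literature.Geometry.Lorentzian

/-! ### Trilinear algebra -/

/-- The operator-norm bound for a continuous trilinear form: `|D u v w| ≤ ‖D‖ ‖u‖ ‖v‖ ‖w‖`.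
[folklore] -/
theorem norm_apply₃_le {E F G : Type*} [NormedAddCommGroup E] [NormedSpace ℝ E]
    [NormedAddCommGroup F] [NormedSpace ℝ F] [NormedAddCommGroup G] [NormedSpace ℝ G]
    (D : E →L[ℝ] F →L[ℝ] G →L[ℝ] ℝ) (u : E) (v : F) (w : G) :
    ‖D u v w‖ ≤ ‖D‖ * ‖u‖ * ‖v‖ * ‖w‖ :=
  (D u v).le_of_opNorm_le (D.le_opNorm₂ u v) w

/-- **The Koszul/Christoffel trick.** For a symmetric bilinear form `A`, a symmetric vector-valued
bilinear map `H` (a Hessian) and a linear map `L` (a Jacobian), the quantity `A(H(u, v), L w)` is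
recovered from the combination `S(u, v, w) := A(H(u, v), L w) + A(L v, H(u, w))` (which is what
differentiating a pulled-back metric produces) by the alternating sum
`2 A(H(u, v), L w) = S(u, v, w) + S(v, u, w) − S(w, u, v)` — the algebra behind the Koszul formula
(O'Neill 1983, Ch. 3, Thm. 3.11) and the classical expression of the Christoffel symbols through
first derivatives of the metric (ibid., Prop. 3.13). [folklore] -/
theorem two_mul_apply_apply_eq_koszul {E F : Type*} [NormedAddCommGroup E] [NormedSpace ℝ E]
    [NormedAddCommGroup F] [NormedSpace ℝ F] (A : F →L[ℝ] F →L[ℝ] ℝ) (H : E →L[ℝ] E →L[ℝ] F)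
    (L : E →L[ℝ] F) (hA : ∀ p q, A p q = A q p) (hH : ∀ u v, H u v = H v u) (u v w : E) :
    2 * A (H u v) (L w) =
      (A (H u v) (L w) + A (L v) (H u w)) + (A (H v u) (L w) + A (L u) (H v w)) -
        (A (H w u) (L v) + A (L u) (H w v)) := by
  rw [hH v u, hH w u, hH w v, hA (L v) (H u w), hA (L u) (H v w)]
  ring

/-- A continuous linear self-map of a finite-dimensional space which is bounded below,
`‖v‖ ≤ Θ ‖L v‖`, is injective, hence onto, and the preimage of `q` has norm `≤ Θ ‖q‖`. [folklore] -/
theorem exists_apply_eq_and_norm_le {E : Type*} [NormedAddCommGroup E] [NormedSpace ℝ E]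
    [FiniteDimensional ℝ E] {L : E →L[ℝ] E} {Θ : ℝ} (hlow : ∀ v, ‖v‖ ≤ Θ * ‖L v‖) (q : E) :
    ∃ w, L w = q ∧ ‖w‖ ≤ Θ * ‖q‖ := by
  have hinj : Function.Injective (L : E →ₗ[ℝ] E) := fun a b hab ↦ by
    have hab' : L a = L b := hab
    have h := hlow (a - b)
    rw [map_sub, hab', sub_self, norm_zero, mul_zero] at h
    exact sub_eq_zero.1 (norm_le_zero_iff.1 h)
  obtain ⟨w, hw⟩ := LinearMap.injective_iff_surjective.1 hinj q
  rw [ContinuousLinearMap.coe_coe] at hw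
  exact ⟨w, hw, hw ▸ hlow w⟩

/-! ### Differentiating the intertwining identity -/

/-- **First variation of the transformation law of a metric.** If `θ` is `C²` on an open set
`s ∋ x` and intertwines two fields of bilinear forms there, `bilinPullback θ B₂ = B₁` on `s`
(`B₁(y)(v, w) = B₂(θ y)(Dθ_y v, Dθ_y w)`, O'Neill 1983, Ch. 3, Def. 3.9), with `B₁` differentiable
at `x` and `B₂` at `θ x`, then differentiating at `x` in the direction `u` (Leibniz and chain
rules) gives, with `L = Dθ(x)` and `H = D²θ(x) = fderiv (fderiv θ) x`,
`DB₁(x)[u](v, w) = DB₂(θ x)[L u](L v, L w) + B₂(θ x)(H(u, v), L w) + B₂(θ x)(L v, H(u, w))` —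
the identity whose symmetrisation is the transformation law of the Christoffel symbols
(ibid., Prop. 3.13, Prop. 3.59). [folklore] -/
theorem fderiv_apply₃_eq_of_bilinPullback_eq {θ : E4 → E4} {B₁ B₂ : E4 → E4 →L[ℝ] E4 →L[ℝ] ℝ}
    {s : Set E4} {x : E4} (hs : IsOpen s) (hx : x ∈ s) (hθ : ContDiffOn ℝ 2 θ s)
    (hB₁ : DifferentiableAt ℝ B₁ x) (hB₂ : DifferentiableAt ℝ B₂ (θ x))
    (hpull : ∀ y ∈ s, bilinPullback θ B₂ y = B₁ y) (u v w : E4) :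
    fderiv ℝ B₁ x u v w =
      fderiv ℝ B₂ (θ x) (fderiv ℝ θ x u) (fderiv ℝ θ x v) (fderiv ℝ θ x w) +
        (B₂ (θ x) (fderiv ℝ (fderiv ℝ θ) x u v) (fderiv ℝ θ x w) +
          B₂ (θ x) (fderiv ℝ θ x v) (fderiv ℝ (fderiv ℝ θ) x u w)) := by
  have hθx : ContDiffAt ℝ 2 θ x := hθ.contDiffAt (hs.mem_nhds hx)
  have hdθ : HasFDerivAt θ (fderiv ℝ θ x) x := (hθx.differentiableAt two_ne_zero).hasFDerivAt
  have hdθ' : HasFDerivAt (fderiv ℝ θ) (fderiv ℝ (fderiv ℝ θ) x) x :=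
    ((hθx.fderiv_right (m := 1) le_rfl).differentiableAt one_ne_zero).hasFDerivAt
  have hv := hdθ'.clm_apply (hasFDerivAt_const v x)
  have hw := hdθ'.clm_apply (hasFDerivAt_const w x)
  have hR := ((hB₂.hasFDerivAt.comp x hdθ).clm_apply hv).clm_apply hw
  have hL := (hB₁.hasFDerivAt.clm_apply (hasFDerivAt_const v x)).clm_apply
    (hasFDerivAt_const w x)
  have heq : (fun y ↦ B₁ y v w) =ᶠ[𝓝 x]
      fun y ↦ (B₂ ∘ θ) y (fderiv ℝ θ y v) (fderiv ℝ θ y w) := by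
    filter_upwards [hs.mem_nhds hx] with y hy
    rw [← hpull y hy, bilinPullback_apply, Function.comp_apply]
  have key := congrArg (fun T : E4 →L[ℝ] ℝ ↦ T u) (hL.unique (hR.congr_of_eventuallyEq heq))
  simp only [add_apply, ContinuousLinearMap.comp_apply, ContinuousLinearMap.flip_apply, zero_apply,
    map_zero, zero_add, Function.comp_apply] at key
  linear_combination key

/-! ### The Christoffel transport estimate -/

/-- **Christoffel transport, explicit form.** Let `θ : E4 → E4` be `C²` on an open set `s ∋ x`
and intertwine two fields of bilinear forms there, `bilinPullback θ B₂ = B₁` on `s`, with `B₁`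
differentiable at `x` and `B₂` at `θ x`. Assume `B₂(θ x)` is symmetric and `ν`-nondegenerate
(`‖p‖ ≤ ν ‖B₂(θ x) p‖`), and that the Jacobian is bounded above and below: `‖Dθ(x)‖ ≤ Θ`,
`‖v‖ ≤ Θ ‖Dθ(x) v‖`. Then the Hessian is controlled by the FIRST derivatives of the two fields:
`‖D(Dθ)(x)‖ ≤ (3/2) |ν| (|Θ| + |Θ|⁴) (‖DB₁(x)‖ + ‖DB₂(θ x)‖)`. Proof: differentiate the identity
(`fderiv_apply₃_eq_of_bilinPullback_eq`), symmetrise by the Koszul trick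
(`two_mul_apply_apply_eq_koszul`; the Hessian is symmetric, `ContDiffAt.isSymmSndFDerivAt`) to
isolate `B₂(θ x)(D²θ(x)(u, v), Dθ(x) w)`, and remove `Dθ(x)` (onto, `exists_apply_eq_and_norm_le`)
and `B₂(θ x)` (nondegenerate). This is the estimate `‖∂²θ‖ ≲ ‖∂g₁‖ + ‖∂g₂‖` read off from the
transformation law of the Christoffel symbols (O'Neill 1983, Ch. 3, Prop. 3.13, Prop. 3.59).
[folklore] -/
theorem norm_fderiv_fderiv_le_of_bilinPullback_eq {Θ ν : ℝ} {θ : E4 → E4}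
    {B₁ B₂ : E4 → E4 →L[ℝ] E4 →L[ℝ] ℝ} {s : Set E4} {x : E4} (hs : IsOpen s) (hx : x ∈ s)
    (hθ : ContDiffOn ℝ 2 θ s) (hB₁ : DifferentiableAt ℝ B₁ x)
    (hB₂ : DifferentiableAt ℝ B₂ (θ x)) (hpull : ∀ y ∈ s, bilinPullback θ B₂ y = B₁ y)
    (hsymm : ∀ p q : E4, B₂ (θ x) p q = B₂ (θ x) q p) (hΘ : ‖fderiv ℝ θ x‖ ≤ Θ)
    (hν : ∀ p : E4, ‖p‖ ≤ ν * ‖B₂ (θ x) p‖) (hlow : ∀ v : E4, ‖v‖ ≤ Θ * ‖fderiv ℝ θ x v‖) :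
    ‖fderiv ℝ (fderiv ℝ θ) x‖ ≤
      3 / 2 * |ν| * (|Θ| + |Θ| ^ 4) * (‖fderiv ℝ B₁ x‖ + ‖fderiv ℝ B₂ (θ x)‖) := by
  have hΘ0 : 0 ≤ Θ := (norm_nonneg _).trans hΘ
  have hθx : ContDiffAt ℝ 2 θ x := hθ.contDiffAt (hs.mem_nhds hx)
  -- the differentiated identity, before abbreviating
  have hder : ∀ u v w : E4, fderiv ℝ B₁ x u v w =
      fderiv ℝ B₂ (θ x) (fderiv ℝ θ x u) (fderiv ℝ θ x v) (fderiv ℝ θ x w) +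
        (B₂ (θ x) (fderiv ℝ (fderiv ℝ θ) x u v) (fderiv ℝ θ x w) +
          B₂ (θ x) (fderiv ℝ θ x v) (fderiv ℝ (fderiv ℝ θ) x u w)) :=
    fderiv_apply₃_eq_of_bilinPullback_eq hs hx hθ hB₁ hB₂ hpull
  -- symmetry of the Hessian (`C²` over `ℝ`)
  have hHs : ∀ u v : E4, fderiv ℝ (fderiv ℝ θ) x u v = fderiv ℝ (fderiv ℝ θ) x v u :=
    fun u v ↦ (hθx.isSymmSndFDerivAt (by simp)) u v
  -- abbreviations
  set L : E4 →L[ℝ] E4 := fderiv ℝ θ x with hLdef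
  set H : E4 →L[ℝ] E4 →L[ℝ] E4 := fderiv ℝ (fderiv ℝ θ) x with hHdef
  set A : E4 →L[ℝ] E4 →L[ℝ] ℝ := B₂ (θ x) with hAdef
  set D₁ : E4 →L[ℝ] E4 →L[ℝ] E4 →L[ℝ] ℝ := fderiv ℝ B₁ x with hD₁def
  set D₂ : E4 →L[ℝ] E4 →L[ℝ] E4 →L[ℝ] ℝ := fderiv ℝ B₂ (θ x) with hD₂def
  -- Koszul: isolate `A (H u v) (L w)`
  have hkos : ∀ u v w : E4, 2 * A (H u v) (L w) =
      (D₁ u v w - D₂ (L u) (L v) (L w)) + (D₁ v u w - D₂ (L v) (L u) (L w)) -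
        (D₁ w u v - D₂ (L w) (L u) (L v)) := by
    intro u v w
    rw [two_mul_apply_apply_eq_koszul A H L hsymm hHs u v w, hder u v w, hder v u w, hder w u v]
    ring
  -- the size of the source term `S(u, v, w) = D₁ u v w - D₂ (L u) (L v) (L w)`
  obtain ⟨M, hM0, hMdef⟩ : ∃ M : ℝ, 0 ≤ M ∧ M = ‖D₁‖ + ‖L‖ ^ 3 * ‖D₂‖ :=
    ⟨_, by positivity, rfl⟩
  have hSb : ∀ u v w : E4, |D₁ u v w - D₂ (L u) (L v) (L w)| ≤ M * (‖u‖ * ‖v‖ * ‖w‖) := by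
    intro u v w
    have h1 : |D₁ u v w| ≤ ‖D₁‖ * ‖u‖ * ‖v‖ * ‖w‖ := by
      rw [← Real.norm_eq_abs]
      exact norm_apply₃_le D₁ u v w
    have h2 : |D₂ (L u) (L v) (L w)| ≤ ‖D₂‖ * (‖L‖ * ‖u‖) * (‖L‖ * ‖v‖) * (‖L‖ * ‖w‖) := by
      rw [← Real.norm_eq_abs]
      calc ‖D₂ (L u) (L v) (L w)‖ ≤ ‖D₂‖ * ‖L u‖ * ‖L v‖ * ‖L w‖ := norm_apply₃_le D₂ _ _ _
        _ ≤ ‖D₂‖ * (‖L‖ * ‖u‖) * (‖L‖ * ‖v‖) * (‖L‖ * ‖w‖) := by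
          gcongr <;> exact L.le_opNorm _
    calc |D₁ u v w - D₂ (L u) (L v) (L w)| ≤ |D₁ u v w| + |D₂ (L u) (L v) (L w)| :=
          abs_sub _ _
      _ ≤ ‖D₁‖ * ‖u‖ * ‖v‖ * ‖w‖ + ‖D₂‖ * (‖L‖ * ‖u‖) * (‖L‖ * ‖v‖) * (‖L‖ * ‖w‖) :=
          add_le_add h1 h2
      _ = M * (‖u‖ * ‖v‖ * ‖w‖) := by
          rw [hMdef]
          ring
  -- hence the size of `A (H u v) (L w)`
  have hQ : ∀ u v w : E4, |A (H u v) (L w)| ≤ 3 / 2 * M * (‖u‖ * ‖v‖ * ‖w‖) := by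
    intro u v w
    obtain ⟨e1l, e1r⟩ := abs_le.1 (hSb u v w)
    obtain ⟨e2l, e2r⟩ := abs_le.1 (hSb v u w)
    obtain ⟨e3l, e3r⟩ := abs_le.1 (hSb w u v)
    have h := hkos u v w
    rw [abs_le]
    constructor <;> linarith
  -- `L` is onto with `‖L⁻¹‖ ≤ Θ`: the size of the linear form `A (H u v)`
  have hAH : ∀ u v : E4, ‖A (H u v)‖ ≤ 3 / 2 * M * Θ * (‖u‖ * ‖v‖) := by
    intro u v
    refine ContinuousLinearMap.opNorm_le_bound _
      (mul_nonneg (mul_nonneg (mul_nonneg (by norm_num) hM0) hΘ0) (by positivity)) fun q ↦ ?_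
    obtain ⟨w, rfl, hw⟩ := exists_apply_eq_and_norm_le hlow q
    calc ‖A (H u v) (L w)‖ = |A (H u v) (L w)| := Real.norm_eq_abs _
      _ ≤ 3 / 2 * M * (‖u‖ * ‖v‖ * ‖w‖) := hQ u v w
      _ ≤ 3 / 2 * M * (‖u‖ * ‖v‖ * (Θ * ‖L w‖)) :=
          mul_le_mul_of_nonneg_left (mul_le_mul_of_nonneg_left hw (by positivity))
            (mul_nonneg (by norm_num) hM0)
      _ = 3 / 2 * M * Θ * (‖u‖ * ‖v‖) * ‖L w‖ := by ring
  -- nondegeneracy of `A`: the size of `H u v`, i.e. the Hessian bound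
  have hL3 : ‖L‖ ^ 3 ≤ Θ ^ 3 := pow_le_pow_left₀ (norm_nonneg _) hΘ 3
  have hMΘ : M * Θ ≤ (Θ + Θ ^ 4) * (‖D₁‖ + ‖D₂‖) := by
    rw [hMdef]
    nlinarith [mul_le_mul_of_nonneg_right hL3 (mul_nonneg (norm_nonneg D₂) hΘ0),
      mul_nonneg hΘ0 (norm_nonneg D₂), mul_nonneg (pow_nonneg hΘ0 4) (norm_nonneg D₁),
      norm_nonneg D₁, norm_nonneg D₂]
  have hC0 : 0 ≤ 3 / 2 * |ν| * (|Θ| + |Θ| ^ 4) * (‖D₁‖ + ‖D₂‖) := by positivity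
  refine ContinuousLinearMap.opNorm_le_bound _ hC0 fun u ↦ ?_
  refine ContinuousLinearMap.opNorm_le_bound _ (mul_nonneg hC0 (norm_nonneg u)) fun v ↦ ?_
  have h1 : ‖H u v‖ ≤ |ν| * ‖A (H u v)‖ :=
    (hν (H u v)).trans (mul_le_mul_of_nonneg_right (le_abs_self ν) (norm_nonneg _))
  rw [abs_of_nonneg hΘ0]
  calc ‖H u v‖ ≤ |ν| * (3 / 2 * M * Θ * (‖u‖ * ‖v‖)) :=
        h1.trans (mul_le_mul_of_nonneg_left (hAH u v) (abs_nonneg ν))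
    _ = 3 / 2 * |ν| * (M * Θ) * (‖u‖ * ‖v‖) := by ring
    _ ≤ 3 / 2 * |ν| * ((Θ + Θ ^ 4) * (‖D₁‖ + ‖D₂‖)) * (‖u‖ * ‖v‖) := by gcongr
    _ = 3 / 2 * |ν| * (Θ + Θ ^ 4) * (‖D₁‖ + ‖D₂‖) * ‖u‖ * ‖v‖ := by ring

/-- **Christoffel transport (registered sub-goal of `stub_glueForwardChain`, seam rigidity (G1)).**
For every Jacobian bound `Θ` and nondegeneracy constant `ν` there is `K = K(Θ, ν) ≥ 0`
(namely `K = (3/2) |ν| (|Θ| + |Θ|⁴)`) such that: whenever a map `θ : E4 → E4`, `C²` on an open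
set `s ∋ x`, intertwines two fields of bilinear forms on `s` (`bilinPullback θ B₂ = B₁`, i.e.
`B₁(y)(v, w) = B₂(θ y)(Dθ_y v, Dθ_y w)` — the two pulled-back metrics of consecutive window
charts agree through the transition map), `B₁` is differentiable at `x` and `B₂` at `θ x`,
`B₂(θ x)` is symmetric and `ν`-nondegenerate, and `Dθ(x)` is bounded by `Θ` above and by `Θ⁻¹`
below, the Hessian of `θ` at `x` is bounded by `K` times the first derivatives of the two metric
fields: `‖D²θ(x)‖ ≤ K (‖DB₁(x)‖ + ‖DB₂(θ x)‖)`. With `B₁, B₂` both `ε`-close in `C¹` to the flat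
metric this is `‖D²θ‖ ≲ ε`: the transformation law of the Christoffel symbols
(O'Neill 1983, Ch. 3, Prop. 3.13, Prop. 3.59) read as an estimate. [folklore] -/
theorem norm_iteratedFDeriv_two_le_of_bilinPullback_eq : ∀ (Θ ν : ℝ), ∃ K : ℝ, 0 ≤ K ∧ ∀ (θ : E4 → E4) (B₁ B₂ : E4 → E4 →L[ℝ] E4 →L[ℝ] ℝ) (s : Set E4) (x : E4), IsOpen s → x ∈ s → ContDiffOn ℝ 2 θ s → DifferentiableAt ℝ B₁ x → DifferentiableAt ℝ B₂ (θ x) → (∀ y ∈ s, Literature.Geometry.Lorentzian.bilinPullback θ B₂ y = B₁ y) → (∀ p q : E4, B₂ (θ x) p q = B₂ (θ x) q p) → ‖fderiv ℝ θ x‖ ≤ Θ → (∀ p : E4, ‖p‖ ≤ ν * ‖(B₂ (θ x)) p‖) → (∀ v : E4, ‖v‖ ≤ Θ * ‖fderiv ℝ θ x v‖) → ‖iteratedFDeriv ℝ 2 θ x‖ ≤ K * (‖fderiv ℝ B₁ x‖ + ‖fderiv ℝ B₂ (θ x)‖) := by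
  intro Θ ν
  refine ⟨3 / 2 * |ν| * (|Θ| + |Θ| ^ 4), by positivity, ?_⟩
  intro θ B₁ B₂ s x hs hx hθ hB₁ hB₂ hpull hsymm hΘ hν hlow
  rw [← norm_iteratedFDeriv_fderiv, norm_iteratedFDeriv_one]
  exact norm_fderiv_fderiv_le_of_bilinPullback_eq hs hx hθ hB₁ hB₂ hpull hsymm hΘ hν hlow

end Summit.FinalStateConjecture.FinalStateConjecture.Theorems.RenormalisedDrift.DriftCapture

end
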